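import Summits.Schanuel.Schanuel.Theorems.ZilberEacBranchRamifiedWitness
import HarnessLib

/-!
# Arbitrary base branches, XIV: the CHART CONSTANT `m′(0)^k = 2πi` and the TOP COEFFICIENT of the
# phase polynomial, `Π_M = Φ(0)·m′(0)^M`

HONEST FRAMING.  Cell `pub-schanuel` (Zilber's Exponential-Algebraic Closedness, case ladder;
host summit Schanuel), seat 2, gen 28.  The chart `m` of file LVII (`2πi·m(s)^{-k} = s^{-k} −
log(ψ(s)/θ) − τ`, `m(0) = 0`, `m′(0) ≠ 0`) and the witness of file I of this series (phase
splitting `Φ(s)s^{-M} = Π(1/m(s)) + r(m(s))`) are existential statements; two quantitative facts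
about them are needed when the second coordinate does NOT grow faster than the first:
* **`deriv_chart_pow_eq`** — `m′(0)^k = 2πi` (from the chart identity: `(m(s)/s)^k → 2πi`);
* **`laurentPart_coeff_eq`** — if `M ≥ 1`, `deg Π ≤ M` and `r(m(s)) = Φ(s)s^{-M} − Π(1/m(s))`
  near `0`, then `Π_M = Φ(0)·m′(0)^M` (multiply by `m(s)^M` and let `s → 0`).
Hence the leading coefficient of the phase polynomial along a branch with EQUAL pole orders
(`M = k`) is `2πi·Φ(0)`, whose real part `−2π·Im Φ(0)` is nonzero exactly when the asymptotic
direction `x₁/x₀ → Φ(0)` of the base branch is NON-REAL — the growth regime of file XV.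
[folklore analysis]; nothing here is specific to Schanuel's conjecture (neither used nor implied);
Mantova–Masser's question (PLMS 2024 §1 p. 5) and EC(3,2) stay OPEN.
-/

noncomputable section

open Filter Topology Polynomial Complex

set_option linter.dupNamespace false

namespace Summit.Schanuel.Schanuel.Theorems

/-- `m(s)/s → m′(0)` along the punctured neighbourhood, for `m` analytic at `0` with `m(0) = 0`.
[folklore] -/
theorem tendsto_div_of_analyticAt_zero {m : ℂ → ℂ} (hman : AnalyticAt ℂ m 0) (hm0 : m 0 = 0) :
    Tendsto (fun s => m s / s) (𝓝[≠] (0 : ℂ)) (𝓝 (deriv m 0)) := by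
  have h := hman.differentiableAt.hasDerivAt.tendsto_slope_zero
  -- `slope` form: `t⁻¹ • (m (0 + t) - m 0) → deriv m 0`
  refine (h.comp (tendsto_nhdsWithin_iff.2 ⟨tendsto_nhdsWithin_of_tendsto_nhds tendsto_id,
    eventually_mem_nhdsWithin⟩)).congr' ?_
  filter_upwards [self_mem_nhdsWithin] with s hs
  simp only [Function.comp_apply, id_eq, zero_add, hm0, sub_zero, smul_eq_mul]
  rw [div_eq_inv_mul]

/-- **The chart constant: `m′(0)^k = 2πi`.** [folklore] (new in this form) -/
theorem deriv_chart_pow_eq {ψ : ℂ → ℂ} (hψ : AnalyticAt ℂ ψ 0) {θ : ℂ} (hθ0 : θ ≠ 0) (hψ0 : ψ 0 = θ)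
    {τ : ℂ} {k : ℕ} (hk : 1 ≤ k) {m : ℂ → ℂ} (hman : AnalyticAt ℂ m 0) (hm0 : m 0 = 0)
    (hchart : ∀ᶠ s in 𝓝 (0 : ℂ), AnalyticAt ℂ ψ s ∧ ψ s ≠ 0 ∧ ψ s / θ ∈ Complex.slitPlane ∧
        ‖Complex.log (ψ s / θ)‖ < 1 ∧
        (s ≠ 0 → m s ≠ 0 ∧
          (2 * Real.pi * I) * (m s ^ k)⁻¹ = (s ^ k)⁻¹ - Complex.log (ψ s / θ) - τ)) :
    deriv m 0 ^ k = 2 * Real.pi * I := by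
  -- `Λ(s) = log(ψ s/θ) → 0`
  set Λ : ℂ → ℂ := fun s => Complex.log (ψ s / θ) with hΛ
  have hΛ0 : Λ 0 = 0 := by simp [hΛ, hψ0, div_self hθ0]
  have hΛcont : ContinuousAt Λ 0 := by
    have h1 : ContinuousAt (fun s => ψ s / θ) 0 := hψ.continuousAt.div_const θ
    have hslit : ψ 0 / θ ∈ Complex.slitPlane := by
      rw [hψ0, div_self hθ0]; exact Complex.one_mem_slitPlane
    exact ContinuousAt.comp (f := fun s => ψ s / θ) (continuousAt_clog hslit) h1
  -- `D(s) = 1 − s^k (Λ s + τ) → 1`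
  set D : ℂ → ℂ := fun s => 1 - s ^ k * (Λ s + τ) with hD
  have hDcont : ContinuousAt D 0 :=
    continuousAt_const.sub ((continuousAt_id.pow k).mul (hΛcont.add continuousAt_const))
  have hD0 : D 0 = 1 := by simp [hD, zero_pow (by omega : k ≠ 0)]
  have hDlim : Tendsto D (𝓝[≠] (0 : ℂ)) (𝓝 1) := by
    have h := hDcont.tendsto
    rw [hD0] at h
    exact h.mono_left nhdsWithin_le_nhds
  -- `(m s / s)^k = 2πi / D(s)` for small `s ≠ 0`
  have hid : ∀ᶠ s in 𝓝[≠] (0 : ℂ), (m s / s) ^ k = (2 * Real.pi * I) / D s := by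
    have hch := eventually_nhdsWithin_iff.2 (hchart.mono fun s h (hs : s ∈ ({0}ᶜ : Set ℂ)) => h.2.2.2.2 hs)
    filter_upwards [hch, self_mem_nhdsWithin] with s hs (hs0 : s ≠ 0)
    obtain ⟨hms, hc⟩ := hs
    have hsk : s ^ k ≠ 0 := pow_ne_zero _ hs0
    have hmk : m s ^ k ≠ 0 := pow_ne_zero _ hms
    have h2πI : (2 * Real.pi * I : ℂ) ≠ 0 := by simp [Real.pi_ne_zero, Complex.I_ne_zero]
    -- from the chart identity: `2πi s^k = m^k (1 − s^k(Λ + τ)) = m^k D`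
    have e1 : (2 * Real.pi * I) * s ^ k = m s ^ k * D s := by
      rw [hD]
      simp only [hΛ]
      field_simp at hc
      linear_combination hc
    have hDs : D s ≠ 0 := by
      intro h0
      rw [h0, mul_zero] at e1
      exact (mul_ne_zero h2πI hsk) e1
    rw [div_pow, div_eq_div_iff hsk hDs]
    linear_combination -e1
  -- limits
  have hlim₁ : Tendsto (fun s => (m s / s) ^ k) (𝓝[≠] (0 : ℂ)) (𝓝 (deriv m 0 ^ k)) :=
    (tendsto_div_of_analyticAt_zero hman hm0).pow k
  have hlim₂ : Tendsto (fun s => (2 * Real.pi * I) / D s) (𝓝[≠] (0 : ℂ)) (𝓝 (2 * Real.pi * I)) := by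
    have h := (tendsto_const_nhds (x := (2 * Real.pi * I : ℂ))).div hDlim one_ne_zero
    rw [div_one] at h
    exact h
  exact tendsto_nhds_unique (hlim₁.congr' hid) hlim₂

/-- `u^M · Π(1/u) → Π_M` as `u → 0`, for `deg Π ≤ M`. [folklore] -/
theorem tendsto_pow_mul_eval_inv {Pl : ℂ[X]} {M : ℕ} (hdeg : Pl.natDegree ≤ M) :
    Tendsto (fun u : ℂ => u ^ M * Pl.eval u⁻¹) (𝓝[≠] (0 : ℂ)) (𝓝 (Pl.coeff M)) := by
  -- `u^M Π(1/u) = Σ_{i ≤ M} Π_i u^{M-i}` for `u ≠ 0`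
  have hid : ∀ᶠ u in 𝓝[≠] (0 : ℂ), u ^ M * Pl.eval u⁻¹ =
      ∑ i ∈ Finset.range (M + 1), Pl.coeff i * u ^ (M - i) := by
    filter_upwards [self_mem_nhdsWithin] with u (hu : u ≠ 0)
    rw [Polynomial.eval_eq_sum_range' (Nat.lt_succ_of_le hdeg), Finset.mul_sum]
    refine Finset.sum_congr rfl fun i hi => ?_
    have hi' : i ≤ M := Nat.lt_succ_iff.1 (Finset.mem_range.1 hi)
    rw [inv_pow, ← div_eq_mul_inv, mul_div_assoc', mul_comm (u ^ M), mul_div_assoc,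
      pow_sub₀ _ hu hi', div_eq_mul_inv]
  -- the limit of the polynomial in `u`
  have hcont : Tendsto (fun u : ℂ => ∑ i ∈ Finset.range (M + 1), Pl.coeff i * u ^ (M - i))
      (𝓝[≠] (0 : ℂ)) (𝓝 (∑ i ∈ Finset.range (M + 1), Pl.coeff i * (0 : ℂ) ^ (M - i))) := by
    refine (tendsto_finsetSum _ fun i _ => ?_).mono_left nhdsWithin_le_nhds
    exact tendsto_const_nhds.mul ((continuous_pow _).tendsto 0)
  have hval : ∑ i ∈ Finset.range (M + 1), Pl.coeff i * (0 : ℂ) ^ (M - i) = Pl.coeff M := by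
    rw [Finset.sum_eq_single_of_mem M (Finset.mem_range.2 (Nat.lt_succ_self M))]
    · simp
    · intro i hi hiM
      have : M - i ≠ 0 := by
        have := Nat.lt_succ_iff.1 (Finset.mem_range.1 hi); omega
      rw [zero_pow this, mul_zero]
  rw [hval] at hcont
  exact hcont.congr' (hid.mono fun u h => h.symm)

/-- **The top coefficient of the phase polynomial: `Π_M = Φ(0)·m′(0)^M`.**  [folklore]
(new in this form) -/
theorem laurentPart_coeff_eq {m : ℂ → ℂ} (hman : AnalyticAt ℂ m 0) (hm0 : m 0 = 0)
    (hmne : ∀ᶠ s in 𝓝[≠] (0 : ℂ), m s ≠ 0) {Φ : ℂ → ℂ} (hΦ : AnalyticAt ℂ Φ 0) {M : ℕ} (hM : 1 ≤ M)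
    {Pl : ℂ[X]} (hdeg : Pl.natDegree ≤ M) {r : ℂ → ℂ} (hr : AnalyticAt ℂ r 0)
    (hside : ∀ᶠ s in 𝓝[≠] (0 : ℂ), r (m s) = Φ s * (s ^ M)⁻¹ - Pl.eval (m s)⁻¹) :
    Pl.coeff M = Φ 0 * deriv m 0 ^ M := by
  -- `m → 0` along the punctured neighbourhood, into the punctured neighbourhood
  have hmtend : Tendsto m (𝓝[≠] (0 : ℂ)) (𝓝[≠] 0) := by
    refine tendsto_nhdsWithin_iff.2 ⟨?_, hmne⟩
    have h := hman.continuousAt.tendsto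
    rw [hm0] at h
    exact h.mono_left nhdsWithin_le_nhds
  -- LHS limit: `m(s)^M Π(1/m(s)) → Π_M`
  have hlim₁ : Tendsto (fun s => m s ^ M * Pl.eval (m s)⁻¹) (𝓝[≠] (0 : ℂ)) (𝓝 (Pl.coeff M)) :=
    (tendsto_pow_mul_eval_inv hdeg).comp hmtend
  -- RHS limit: `Φ(s) (m s / s)^M − m(s)^M r(m s) → Φ(0) m′(0)^M`
  have hlim₂ : Tendsto (fun s => Φ s * (m s / s) ^ M - m s ^ M * r (m s)) (𝓝[≠] (0 : ℂ))
      (𝓝 (Φ 0 * deriv m 0 ^ M - 0 ^ M * r 0)) := by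
    refine ((hΦ.continuousAt.tendsto.mono_left nhdsWithin_le_nhds).mul
      ((tendsto_div_of_analyticAt_zero hman hm0).pow M)).sub ?_
    have hm' : Tendsto m (𝓝[≠] (0 : ℂ)) (𝓝 0) := by
      have h := hman.continuousAt.tendsto; rw [hm0] at h; exact h.mono_left nhdsWithin_le_nhds
    have hr' : Tendsto (fun s => r (m s)) (𝓝[≠] (0 : ℂ)) (𝓝 (r 0)) :=
      hr.continuousAt.tendsto.comp hm'
    exact (hm'.pow M).mul hr'
  -- the two functions agree on the punctured neighbourhood
  have hid : ∀ᶠ s in 𝓝[≠] (0 : ℂ),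
      m s ^ M * Pl.eval (m s)⁻¹ = Φ s * (m s / s) ^ M - m s ^ M * r (m s) := by
    filter_upwards [hside, self_mem_nhdsWithin] with s hs (hs0 : s ≠ 0)
    rw [hs, div_pow]
    field_simp
    ring
  have h := tendsto_nhds_unique (hlim₁.congr' hid) hlim₂
  rw [zero_pow (by omega : M ≠ 0), zero_mul, sub_zero] at h
  exact h

end Summit.Schanuel.Schanuel.Theorems
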